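import Summits.Langlands.Langlands.Theses.MinimalLevelDescent

/-!
# Glue of the layer-2 split of `LevelPrimeDescent` (route MinimalLevelDescent, rev 1)

Closes the glue item `stmt-Langlands-28626` of `route-Langlands-MinimalLevelDescent`:
`LevelPrimeDescent_of_split : WeightMove → LevelMove → MinimalCrystallineDescent → LevelPrimeDescent`.
Pure logic — the weight move `WeightMove` reduces `LevelPrimeDescent` at height `(k, ℓ)` to the
crystalline-above-`ℓ` case, and that case is assembled by excluded middle on «`ρ` is lift-minimal away
from `ℓ`»: a crystalline `ρ` that is non-minimal at some `w ∤ ℓ` (witnessed by a residual representation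
`τ` with trivial inertia action at `w`) is handled by `LevelMove`, a lift-minimal one by
`MinimalCrystallineDescent`.  This is the lens-4 node proof `LonelyNormalForm.levelPrimeDescent_of_moves`
(decomp-langlands, 2026-08-30; certified against a mock render of the split and, by the critic, against the
route of record by `Iff.rfl`), transported to the tree's declarations.  No definitions, no new mathematics.
-/

set_option linter.dupNamespace false -- project-wide option; `Summit.Langlands.Langlands` is the mandated namespace

namespace Summit.Langlands.Langlands.Theorems

open Summit.Langlands.Langlands.Theses in
/-- The glue item `stmt-Langlands-28626` of route MinimalLevelDescent (rev 1): the three children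
`WeightMove` (W), `LevelMove` (L) and `MinimalCrystallineDescent` (M) of the split of `LevelPrimeDescent`
(D) imply the parent.  Proof: feed W the crystalline case; build the crystalline case by cases on
lift-minimality of `ρ` away from `ℓ` — the non-minimal case is L (with the witnessed residual
representation unramified at `w`), the minimal case is M. -/
theorem LevelPrimeDescent_of_split_proof :
    Summit.Langlands.Langlands.Theses.MinimalLevelDescent.LevelPrimeDescent_of_split := by
  intro hWM hLM hM hW hL k ℓ _ h02 hIH
  refine hWM hW hL k ℓ h02 hIH ?_
  intro K _ _ n hcpt hn ι ρ hirr hgeo hcrys hlev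
  by_cases hmin : ∀ w : IsDedekindDomain.HeightOneSpectrum (NumberField.RingOfIntegers K),
      ((ℓ : ℕ) : NumberField.RingOfIntegers K) ∉ w.asIdeal → ¬ ρ.IsUnramifiedAt w →
        ∀ τ : Field.absoluteGaloisGroup K →* Matrix.GeneralLinearGroup (Fin n)
            (Literature.NumberTheory.GaloisRepresentations.padicAlgClResidueField ℓ),
          ρ.IsResidualRepOf
              (RingHom.id (Literature.NumberTheory.GaloisRepresentations.padicAlgClResidueField ℓ)) τ →
            ¬ (∀ 𝔓 ∈ w.primesAbove, ∀ σ ∈ 𝔓.inertia (Field.absoluteGaloisGroup K), τ σ = 1)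
  · exact hM hW hL k ℓ h02 hIH K n hcpt hn ι ρ hirr hgeo hcrys hlev hmin
  · push Not at hmin
    obtain ⟨w, hwℓ, hram, τ, hτ, htriv⟩ := hmin
    exact hLM hW hL k ℓ h02 hIH K n hcpt hn ι ρ hirr hgeo hcrys hlev ⟨w, hwℓ, hram, τ, hτ, htriv⟩

end Summit.Langlands.Langlands.Theorems
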